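import Summits.ResolutionOfSingularities.ResolutionOfSingularities.Theses.RuledResidues

/-!
# Crux `NonRuledDivisors` (stmt-ResolutionOfSingularities-18075, route `RuledResidues`) —
# regime exclusion: NO WITNESS when `K/k` is algebraic (the transcendence of `K/k` is load-bearing)

`NonRuledDivisors` (THE WITNESS of the refutation-shaped route) asks for a prime `p`, a field `k` of
characteristic `p`, a field `K` with an affine model `R` (`R.FG`, `Frac R = K`) and an INFINITE set
of valuation rings `W` of `K` containing `k` that are DVRs, essentially of finite type, centred at a
non-regular point of `Spec R`, with residue field not ruled over `k`.

Negative-side support (crux disprover, cycle 1), sorry-free and definition-free: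

* `nonRuledDivisorsNeg_mem_of_isAlgebraic` — a valuation ring of `K` containing `k` contains every
  element algebraic over `k` (valuation rings are integrally closed);
* `nonRuledDivisorsNeg_not_dvr_of_forall_mem` — a valuation ring equal to `K` is not a DVR;
* `nonRuledDivisors_noWitness_of_isAlgebraic` — hence if `K` is algebraic over `k` the witness set
  (verbatim the crux's set-builder) has NO member at all, for every `R`;
* `nonRuledDivisors_false_with_isAlgebraic` — the crux strengthened by `Algebra.IsAlgebraic k K`
  is FALSE.

Moral for hunters: only the first two conjuncts (`k ⊆ W`, DVR) are used; the degenerate regime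
`trdeg_k K = 0` is empty for a trivial reason, and (informally, not proved here) `trdeg 1` is finite
(Krull–Akizuki) and `trdeg 2, 3` are finite by Lipman / Cossart–Piltant + the route's two kills, so a
witness needs `trdeg_k K ≥ 4`.  This file does NOT refute the crux.
-/

set_option linter.dupNamespace false

namespace Summit.ResolutionOfSingularities.ResolutionOfSingularities.Theorems

/-- A valuation ring of `K` containing (the image of) `k` contains every element of `K` algebraic
over `k`: valuation rings are integrally closed. [folklore] -/
theorem nonRuledDivisorsNeg_mem_of_isAlgebraic {k K : Type*} [Field k] [Field K] [Algebra k K]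
    (W : ValuationSubring K) (hk : ∀ c : k, algebraMap k K c ∈ W) {x : K}
    (hx : IsAlgebraic k x) : x ∈ W := by
  have hv : W.valuation.Integers W := by
    have h := Valuation.valuationSubring.integers (W.valuation)
    rwa [ValuationSubring.valuationSubring_valuation] at h
  obtain ⟨p, hp, hpx⟩ := hx.isIntegral
  let φ : k →+* W := (algebraMap k K).codRestrict W hk
  have hint : IsIntegral W x := by
    refine ⟨p.map φ, hp.map φ, ?_⟩
    rw [Polynomial.eval₂_map]
    have hcomp : (algebraMap W K).comp φ = algebraMap k K := RingHom.ext fun c => rfl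
    rw [hcomp]
    exact hpx
  exact (W.valuation_le_one_iff x).mp ((hv.isIntegral_iff_v_le_one).mp hint)

/-- A valuation subring that is all of `K` is a field, hence not a discrete valuation ring.
[folklore] -/
theorem nonRuledDivisorsNeg_not_dvr_of_forall_mem {K : Type*} [Field K] (W : ValuationSubring K)
    (h : ∀ x : K, x ∈ W) : ¬ IsDiscreteValuationRing W := by
  intro hW
  apply IsDiscreteValuationRing.not_a_field' (R := W)
  rw [eq_bot_iff]
  intro a ha
  rw [Submodule.mem_bot]
  by_contra hne
  have hne' : (a : K) ≠ 0 := fun h0 => hne (Subtype.ext h0)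
  have hunit : IsUnit a :=
    ⟨⟨a, ⟨(a : K)⁻¹, h _⟩, Subtype.ext (mul_inv_cancel₀ hne'), Subtype.ext (inv_mul_cancel₀ hne')⟩,
      rfl⟩
  exact (IsLocalRing.mem_maximalIdeal _ |>.mp ha) hunit

/-- REGIME EXCLUSION (`trdeg_k K = 0`).  If `K` is algebraic over `k` then NO valuation ring of `K`
lies in the witness set of `NonRuledDivisors` (verbatim set-builder), whatever the affine model `R`:
a place containing `k` is all of `K`, so it is not a DVR. [folklore] -/
theorem nonRuledDivisors_noWitness_of_isAlgebraic {k K : Type} [Field k] [Field K] [Algebra k K]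
    [Algebra.IsAlgebraic k K] (R : Subalgebra k K) (W : ValuationSubring K) :
    W ∉ {W : ValuationSubring K | ∃ hk : (∀ c : k, algebraMap k K c ∈ W), IsDiscreteValuationRing W ∧ (∃ B : Subalgebra k K, B.FG ∧ B.toSubring ≤ W.toSubring ∧ ∀ x : K, x ∈ W → ∃ b s : K, b ∈ B ∧ s ∈ B ∧ s ∉ W.nonunits ∧ x * s = b) ∧ (∃ h : R.toSubring ≤ W.toSubring, ¬ IsRegularLocalRing (Localization.AtPrime (Ideal.comap (Subring.inclusion h) (IsLocalRing.maximalIdeal W)))) ∧ ¬ (∃ (L : Subfield (IsLocalRing.ResidueField W)) (t : IsLocalRing.ResidueField W), (∀ c : k, IsLocalRing.residue W ⟨algebraMap k K c, hk c⟩ ∈ L) ∧ (∀ f : Polynomial L, f ≠ 0 → Polynomial.eval₂ L.subtype t f ≠ 0) ∧ (∀ x : IsLocalRing.ResidueField W, ∃ f g : Polynomial L, Polynomial.eval₂ L.subtype t g ≠ 0 ∧ x * Polynomial.eval₂ L.subtype t g = Polynomial.eval₂ L.subtype t f))} := by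
  rintro ⟨hk, hdvr, -⟩
  exact nonRuledDivisorsNeg_not_dvr_of_forall_mem W
    (fun x => nonRuledDivisorsNeg_mem_of_isAlgebraic W hk (Algebra.IsAlgebraic.isAlgebraic x)) hdvr

/-- The crux STRENGTHENED by `Algebra.IsAlgebraic k K` (everything else verbatim) is FALSE: the
witness set is empty, so certainly not infinite. -/
theorem nonRuledDivisors_false_with_isAlgebraic :
    ¬ ∃ p : ℕ, p.Prime ∧ ∃ (k K : Type) (_ : Field k) (_ : CharP k p) (_ : Field K) (_ : Algebra k K), Algebra.IsAlgebraic k K ∧ ∃ R : Subalgebra k K, R.FG ∧ IsFractionRing R K ∧ Set.Infinite {W : ValuationSubring K | ∃ hk : (∀ c : k, algebraMap k K c ∈ W), IsDiscreteValuationRing W ∧ (∃ B : Subalgebra k K, B.FG ∧ B.toSubring ≤ W.toSubring ∧ ∀ x : K, x ∈ W → ∃ b s : K, b ∈ B ∧ s ∈ B ∧ s ∉ W.nonunits ∧ x * s = b) ∧ (∃ h : R.toSubring ≤ W.toSubring, ¬ IsRegularLocalRing (Localization.AtPrime (Ideal.comap (Subring.inclusion h) (IsLocalRing.maximalIdeal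 W)))) ∧ ¬ (∃ (L : Subfield (IsLocalRing.ResidueField W)) (t : IsLocalRing.ResidueField W), (∀ c : k, IsLocalRing.residue W ⟨algebraMap k K c, hk c⟩ ∈ L) ∧ (∀ f : Polynomial L, f ≠ 0 → Polynomial.eval₂ L.subtype t f ≠ 0) ∧ (∀ x : IsLocalRing.ResidueField W, ∃ f g : Polynomial L, Polynomial.eval₂ L.subtype t g ≠ 0 ∧ x * Polynomial.eval₂ L.subtype t g = Polynomial.eval₂ L.subtype t f))} := by
  rintro ⟨p, -, k, K, _, _, _, _, halg, R, -, -, hinf⟩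
  apply hinf
  convert Set.finite_empty
  exact Set.eq_empty_iff_forall_notMem.mpr fun W => nonRuledDivisors_noWitness_of_isAlgebraic R W

end Summit.ResolutionOfSingularities.ResolutionOfSingularities.Theorems
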